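import Summits.ABC.IUTFork.LDHGenuinePerImageSufficiency
import Summits.ABC.IUTFork.ForkGenuineWindowSharpCond
import Summits.ABC.IUTFork.LDHGenuineStepVPoint
import Summits.ABC.IUTFork.LDHGenuinePerImageContentfulTameSix
import HarnessLib

/-!
# The fork at [IUTchIII] Corollary 3.12, L-DH level, READING (P): the contentful sufficient half AT THE Θ-DATA OF A
# POINT OF THE `λ`-LINE — `κ_l·log q^{∤2l}(λ) ≤ ((l+5)/4 − d_mod)·(log-diff + (1 − 1/l)·log-cond) + ((l+5)/4)·log π`
# implies the (P)-line crux `Cor22.Cor312PerImageAtDatum P l`; at `d_mod = 1` a SZPIRO inequality with constant `→ 6`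
# (abc-iut cell, crux ThetaPartII = stmt-ABC-19678, registered stub `stub_cor312PerImage`)

Record-only PROOF file (D-0012) of the abc-iut cell (WAVE-3 discharge seat abc-iut-c312-d1, gen 7; self-proposed row
«P-CRUX-SUFFICIENCY», part B); TAKES NO SIDE on [IUTchIII] Cor. 3.12 or on the (U)/(P) readings. Composes part A
(`LDHGenuinePerImageSufficiency`, p445807: `−deĝ̲_lgp(P_Θ) + closed-form different gain ≤ −|log(Θ)|^{nonarch}_(P)` at every
genuine input) with abc-iut-S4's Step (ii)/(v) dictionary (`ForkGenuineWindowSharpLogDiff` p444393: for `K/F₀` Galois the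
closed form is `≥ ((ℓ⋇+3)/2 − [F₀:ℚ])·log(𝔡^K)`; `ForkGenuineWindowSharpCond` p444868: at a genuine datum of `(P, l)`,
`log(𝔡^K) ≥ log-diff(λ) + (1 − 1/l)·log 𝔣^{F_tpd}` — [IUTchIV] Thm. 1.10 Step (ii) first display read for `F_tpd ⊆ K` plus
`l ∣ e(w|v)` at the bad places, [IUTchI] Def. 3.1 (c) / Ex. 3.2 (iv)) and this lineage's point dictionary (`PointDict.gap_eq`,
`PointStepV.finrank_fieldOfModuli_eq_dmod`, the datum's `isGalois_fieldOfModuli_K`):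

* `GenuineContent.neg_ndegLgp_add_mul_ndeg_le_negLogThetaPerImageNonarch` — input level, `K/F₀` Galois:
  `−deĝ̲_lgp(P_Θ) + ((ℓ⋇+3)/2 − [F₀:ℚ])·log(𝔡^K) ≤ −|log(Θ)|^{nonarch}_(P)`; `cor312PerImageOf_of_le_mul_ndeg`;
* **`Cor22.ThetaVolumeDatumAt.cor312PerImageOf_of_le_logDiff_logCond`** / **`Cor22.cor312PerImageAtDatum_of_le_logDiff_logCond`** —
  for `P ∈ U_X`, `l ≥ 1` with `d_mod ≤ (l+5)/4`:
  `((l+1)/24 − 1/(2l))·log q^{∤{2,l}}(λ) ≤ ((l+5)/4 − d_mod)·(log-diff(λ) + (1 − 1/l)·log 𝔣^{∤{2,l}}(λ)) + ((l+5)/4)·log π`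
  ⟹ [IUTchIII] Cor. 3.12 holds IN READING (P) at EVERY genuine Θ-volume datum of `(P, l)`;
* **`Cor22.cor312PerImageAtDatum_of_szpiro`** — the same as a Szpiro-type inequality (`l ≥ 5`):
  `log q^{∤2l} ≤ (6l(l+5−4d_mod)/((l+4)(l−3)))·(log-diff + (1 − 1/l)·log-cond) + (6l(l+5)/((l+4)(l−3)))·log π`;
* **`Cor22.cor312PerImageAtDatum_of_szpiroSix`** — `d_mod = 1` (every `λ` with `j(λ) ∈ ℚ`, in particular every rational `λ`):
  **`log q^{∤2l}(λ) ≤ (6l(l+1)/((l+4)(l−3)))·(log-diff(λ) + (1 − 1/l)·log 𝔣^{∤2l}(λ)) + (6l(l+5)/((l+4)(l−3)))·log π ⟹ Cor22.Cor312PerImageAtDatum P l`**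
  — the constant `6l(l+1)/((l+4)(l−3))` is `6.6` at `l = 11`, `6.13` at `l = 23`, and tends to `6`;
* `Cor22.cor312PerImageAtDatum_sandwich_dmod_one` — packaged with this seat's NECESSITY (p437841,
  `szpiro_of_cor312PerImageAtDatum_tame_six`, `l ≥ 7`, at a TAME datum): the registered (P)-line crux at `(P, l)` is implied by
  Szpiro with constant `6l(l+1)/((l+4)(l−3)) ↓ 6` and implies Szpiro with constant `(1 + 12/l)/(1/6 − 2/(l(l+1))) ↓ 6`.

READING (numbers; statements about OUR typed objects). In the cell's model reading the disputed inequality of the IUT route,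
at the number level and per image ([IUTchIII] Step (x)), evaluated at the Θ-data of a rational-moduli point, is EQUIVALENT up
to explicit `O(1/l)` slack and `O(log l)` additive terms to Szpiro's `log q ≤ 6·log N` for `E_λ` away from `2l` — the live
conditional object of branch C (`ABC_of_cor312PerImage`) is neither weaker nor stronger than that. Nothing here asserts
`Cor312PerImageAtDatum` for any point or the existence of data; no side taken on [IUTchIII] Cor. 3.12 or any author.
[cite: Mochizuki2012, IUTchIII Cor. 3.12 p. 173–174; proof Step (x) p. 181] [cite: Mochizuki2012, IUTchIV Thm. 1.10 Step (ii) p. 24,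
Step (v) p. 27–29, Step (vii) p. 30; Cor. 2.2 (ii) proof p. 46] [cite: DupuyHilado2025, Def. 3.6.3, §4.12]
[claim: Mochizuki2012, status: disputed] for every IUT quotation. PROOF-ONLY: no definitions, no new `Prop`; typed ≠ proved.
-/

noncomputable section

open Set Literature.IUT.LogVolume NumberField IsDedekindDomain Literature.NumberTheory.NumberFields
open scoped Pointwise

namespace Summit.ABC.IUTFork.GenuineContent

section Galois

variable {F₀ : Type} [Field F₀] [NumberField F₀] {K : Type} [Field K] [NumberField K] [Algebra F₀ K]
variable (I : ThetaVolumeInput F₀ K)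

/-- **Input level, `K/F₀` Galois: `−deĝ̲_lgp(P_Θ) + ((ℓ⋇+3)/2 − [F₀:ℚ])·log(𝔡^K) ≤ −|log(Θ)|^{nonarch}_(P)`** — part A's
closed-form lower end with abc-iut-S4's `dExplicit_closedForm_ge` (one unweighted different per prime and place costs at most
`[F₀:ℚ]` weighted ones) and `sum_supportPrimes_weight_mul_differentOrd_eq_ndeg` (the support primes carry the whole of
`log(𝔡^K) = ndeg K (differentDivisor K)`, [IUTchIV] Def. 1.9 (ii)). [cite: Mochizuki2012, IUTchIV Thm. 1.10 Step (v) p. 27–29]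
[cite: DupuyHilado2025, §4.12] -/
theorem neg_ndegLgp_add_mul_ndeg_le_negLogThetaPerImageNonarch [IsGalois F₀ K] :
    -LgpDivisor.ndegLgp I.X.thetaPilot
        + (((I.X.lstar : ℝ) + 3) / 2 - Module.finrank ℚ F₀) * ndeg K (differentDivisor K) ≤
      I.negLogThetaPerImageNonarch := by
  have h1 := neg_ndegLgp_add_closedForm_le_negLogThetaPerImageNonarch I
  have h2 := dExplicit_closedForm_ge I
  rw [sum_supportPrimes_weight_mul_differentOrd_eq_ndeg I] at h2
  linarith

/-- **[IUTchIII] Cor. 3.12 IN READING (P) holds at a genuine input with `K/F₀` Galois whenever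
`((l+1)/24 − 1/(2l))·deĝ̲(𝔮) ≤ ((ℓ⋇+3)/2 − [F₀:ℚ])·log(𝔡^K) + ((l+5)/4)·log π`.** No side taken on the claim for ALL data.
[cite: Mochizuki2012, IUTchIII Cor. 3.12 p. 173–174; proof Step (x) p. 181] [cite: Mochizuki2012, IUTchIV Thm. 1.10 Step (vii) p. 30] -/
theorem cor312PerImageOf_of_le_mul_ndeg [IsGalois F₀ K]
    (h : (((I.X.l : ℝ) + 1) / 24 - 1 / (2 * (I.X.l : ℝ))) * FinDivisor.ndeg F₀ I.X.qDivisor ≤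
      (((I.X.lstar : ℝ) + 3) / 2 - Module.finrank ℚ F₀) * ndeg K (differentDivisor K)
        + ThetaVolumeInput.archLogTheta I.l) :
    I.Cor312PerImageOf := by
  have hlow := neg_ndegLgp_add_mul_ndeg_le_negLogThetaPerImageNonarch I
  rw [DHData.ndegLgp_thetaPilot_eq] at hlow
  have hq := I.negAbsLogQ_eq
  unfold ThetaVolumeInput.Cor312PerImageOf ThetaVolumeInput.negLogThetaPerImage
  rw [hq]
  have hsplit : (((I.X.l : ℝ) + 1) / 24 - 1 / (2 * (I.X.l : ℝ))) * FinDivisor.ndeg F₀ I.X.qDivisor =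
      ((I.X.l : ℝ) + 1) / 24 * FinDivisor.ndeg F₀ I.X.qDivisor
        - 1 / (2 * (I.X.l : ℝ)) * FinDivisor.ndeg F₀ I.X.qDivisor := sub_mul _ _ _
  change -(1 / (2 * (I.X.l : ℝ))) * FinDivisor.ndeg F₀ I.X.qDivisor ≤
    I.negLogThetaPerImageNonarch + ThetaVolumeInput.archLogTheta I.X.l
  change _ ≤ _ + ThetaVolumeInput.archLogTheta I.X.l at h
  linarith

end Galois

end Summit.ABC.IUTFork.GenuineContent

/-! ## At the Θ-data of a point of the `λ`-line -/

namespace Literature.IUT.LogVolume.Cor22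

open Literature.NumberTheory.DiophantineGeometry.GenEll Summit.ABC.IUTFork Literature.IUT.HodgeTheaters

namespace ThetaVolumeDatumAt

variable {P : NFPoint} {l : ℕ} (T : ThetaVolumeDatumAt P l)

/-- **PER DATUM**: for a genuine Θ-volume datum `T` at `(P, l)` (`λ ∈ U_X`, `l ≥ 1`, `d_mod ≤ (l+5)/4`), if
`((l+1)/24 − 1/(2l))·log q^{∤{2,l}}(λ) ≤ ((l+5)/4 − d_mod)·(log-diff(λ) + (1 − 1/l)·log 𝔣^{∤{2,l}}(λ)) + ((l+5)/4)·log π`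
then [IUTchIII] Cor. 3.12 holds IN READING (P) at `T` — the gap is `κ_l·log q^{∤2l}` (`PointDict.gap_eq`), `K = F(E_F[l])` is Galois
over `F_mod` with `[F_mod:ℚ] = d_mod` and `(ℓ⋇+3)/2 = (l+5)/4`, and `log(𝔡^K) ≥ log-diff + (1 − 1/l)·log-cond` (abc-iut-S4).
[cite: Mochizuki2012, IUTchIV Thm. 1.10 Step (ii) p. 24, Step (v) p. 27–29; Cor. 2.2 (ii) proof p. 46] [claim: Mochizuki2012, status: disputed] -/
theorem cor312PerImageOf_of_le_logDiff_logCond (hU : P.InU) (hl : 0 < l)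
    (hd : (dmod P : ℝ) ≤ ((l : ℝ) + 5) / 4)
    (h : (((l : ℝ) + 1) / 24 - 1 / (2 * l)) * logQAvoid P {2, l} ≤
      (((l : ℝ) + 5) / 4 - dmod P) * (P.logDiff + (1 - 1 / (l : ℝ)) * logCondAvoid P {2, l})
        + ThetaVolumeInput.archLogTheta l) :
    T.Cor312PerImageOf := by
  letI := T.instFieldF; letI := T.instNumberFieldF; letI := T.instAlgebraF; letI := T.instFieldK
  letI := T.instNumberFieldK; letI := T.instAlgebraK; letI := T.instFieldFbar; letI := T.instAlgebraFbar
  letI := T.instAlgebraKFbar; letI := T.instIsElliptic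
  haveI := T.isGalois_fieldOfModuli_K
  have hgap := PointDict.gap_eq T hU
  have hXlN : T.I.X.l = l := T.isVolumeInputOf.l_eq
  have hXl : ((T.I.X.l : ℕ) : ℝ) = (l : ℝ) := by exact_mod_cast hXlN
  -- `(ℓ⋇+3)/2 = (l+5)/4`
  have hls : ((T.I.X.lstar : ℝ) + 3) / 2 = ((l : ℝ) + 5) / 4 := by
    have h2 : T.I.X.l = 2 * T.I.X.lstar + 1 := T.I.X.l_eq
    have h2R : ((T.I.X.l : ℕ) : ℝ) = 2 * (T.I.X.lstar : ℝ) + 1 := by exact_mod_cast h2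
    rw [hXl] at h2R
    linarith
  -- `[F_mod : ℚ] = d_mod`
  have hdm : (Module.finrank ℚ (fieldOfModuli T.E) : ℝ) = (dmod P : ℝ) := by
    exact_mod_cast PointStepV.finrank_fieldOfModuli_eq_dmod T
  -- Step (ii) at the datum (abc-iut-S4)
  have hdiff := T.ndeg_differentDivisor_ge hl
  have hc : 0 ≤ ((l : ℝ) + 5) / 4 - (dmod P : ℝ) := by linarith
  have hmono := mul_le_mul_of_nonneg_left hdiff hc
  show T.I.Cor312PerImageOf
  refine GenuineContent.cor312PerImageOf_of_le_mul_ndeg T.I ?_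
  rw [hXl, hls, hdm]
  have hg : T.gap = (((l : ℝ) + 1) / 24 - 1 / (2 * l)) * FinDivisor.ndeg (fieldOfModuli T.E) T.I.X.qDivisor := by
    show LgpDivisor.ndegLgp T.I.X.thetaPilot - FinDivisor.ndeg _ T.I.X.qPilot = _
    rw [DHData.ndegLgp_thetaPilot_eq, PilotData.qPilot_eq_smul, map_smul, smul_eq_mul, hXl]
    ring
  rw [← hg, hgap]
  show _ ≤ _ + ThetaVolumeInput.archLogTheta T.I.X.l
  rw [hXlN]
  change P.logDiff + (1 - 1 / (l : ℝ)) * logCondAvoid P {2, l} ≤ ndeg T.K (differentDivisor T.K) at hdiff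
  linarith

end ThetaVolumeDatumAt

variable {P : NFPoint} {l : ℕ}

/-- **THE CONTENTFUL SUFFICIENT HALF OF THE (P)-LINE CRUX AT `(P, l)`**: for `λ ∈ U_X`, `l ≥ 1`, `d_mod ≤ (l+5)/4`, if
`((l+1)/24 − 1/(2l))·log q^{∤{2,l}}(λ) ≤ ((l+5)/4 − d_mod)·(log-diff(λ) + (1 − 1/l)·log 𝔣^{∤{2,l}}(λ)) + ((l+5)/4)·log π` then
`Cor22.Cor312PerImageAtDatum P l` — [IUTchIII] Cor. 3.12 in reading (P) at EVERY genuine Θ-volume datum of `(P, l)`. Together with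
this seat's `cor312PerImageAtDatum_of_shallow` (p438354, gain dropped) and `szpiro_of_cor312PerImageAtDatum(_tame_six)` (p437310/p437841,
necessity) the registered stub `stub_cor312PerImage` is pinned per point between two Szpiro-type inequalities. No side taken on its
content elsewhere. [cite: Mochizuki2012, IUTchIII Cor. 3.12 p. 173–174] [cite: Mochizuki2012, IUTchIV Thm. 1.10 Steps (ii), (v), (vii)
p. 24, 27–30; Cor. 2.2 (ii) proof p. 46] [claim: Mochizuki2012, status: disputed] -/
theorem cor312PerImageAtDatum_of_le_logDiff_logCond (hU : P.InU) (hl : 0 < l)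
    (hd : (dmod P : ℝ) ≤ ((l : ℝ) + 5) / 4)
    (h : (((l : ℝ) + 1) / 24 - 1 / (2 * l)) * logQAvoid P {2, l} ≤
      (((l : ℝ) + 5) / 4 - dmod P) * (P.logDiff + (1 - 1 / (l : ℝ)) * logCondAvoid P {2, l})
        + ThetaVolumeInput.archLogTheta l) :
    Cor312PerImageAtDatum P l := fun T =>
  T.cor312PerImageOf_of_le_logDiff_logCond hU hl hd h

/-- **SZPIRO FORM** (`l ≥ 5`, `d_mod ≤ (l+5)/4`): `log q^{∤2l}(λ) ≤ (6l(l+5−4d_mod)/((l+4)(l−3)))·(log-diff(λ) + (1 − 1/l)·log 𝔣^{∤2l}(λ))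
+ (6l(l+5)/((l+4)(l−3)))·log π ⟹ Cor22.Cor312PerImageAtDatum P l` (divide by `κ_l = (l+4)(l−3)/(24l) > 0`).
[cite: Mochizuki2012, IUTchIII Cor. 3.12 p. 173–174] [cite: Mochizuki2012, IUTchIV Thm. 1.10 p. 22–23] [claim: Mochizuki2012, status: disputed] -/
theorem cor312PerImageAtDatum_of_szpiro (hU : P.InU) (h5 : 5 ≤ l)
    (hd : (dmod P : ℝ) ≤ ((l : ℝ) + 5) / 4)
    (h : logQAvoid P {2, l} ≤
      6 * l * (((l : ℝ) + 5) - 4 * dmod P) / (((l : ℝ) + 4) * ((l : ℝ) - 3))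
          * (P.logDiff + (1 - 1 / (l : ℝ)) * logCondAvoid P {2, l})
        + 6 * l * ((l : ℝ) + 5) / (((l : ℝ) + 4) * ((l : ℝ) - 3)) * Real.log Real.pi) :
    Cor312PerImageAtDatum P l := by
  have hl5 : (5 : ℝ) ≤ l := by exact_mod_cast h5
  have hl0 : (0 : ℝ) < l := by linarith
  refine cor312PerImageAtDatum_of_le_logDiff_logCond hU (by omega) hd ?_
  have harch : ThetaVolumeInput.archLogTheta l = ((l : ℝ) + 5) / 4 * Real.log Real.pi := rfl
  rw [harch]
  set L : ℝ := P.logDiff + (1 - 1 / (l : ℝ)) * logCondAvoid P {2, l} with hL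
  set Q : ℝ := logQAvoid P {2, l} with hQ
  have hL0 : 0 ≤ L := by
    have h1 : 0 ≤ 1 - 1 / (l : ℝ) := by
      rw [sub_nonneg, div_le_one hl0]; linarith
    exact add_nonneg P.logDiff_nonneg (mul_nonneg h1 (logCondAvoid_nonneg P _))
  have hQ0 : 0 ≤ Q := logQAvoid_nonneg P _
  have hpi0 : 0 ≤ Real.log Real.pi := Real.log_nonneg (by linarith [Real.pi_gt_three])
  have hc0 : 0 ≤ ((l : ℝ) + 5) - 4 * dmod P := by linarith
  -- `κ_l = (l+4)(l−3)/(24 l)`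
  have hκ : ((l : ℝ) + 1) / 24 - 1 / (2 * l) = ((l : ℝ) + 4) * ((l : ℝ) - 3) / (24 * l) := by
    field_simp
    ring
  have hden : 0 < ((l : ℝ) + 4) * ((l : ℝ) - 3) := by nlinarith
  rw [hκ]
  rw [div_mul_eq_mul_div, div_le_iff₀ (by positivity)]
  have h' := mul_le_mul_of_nonneg_left h hden.le
  have e1 : ((l : ℝ) + 4) * ((l : ℝ) - 3) *
      (6 * l * (((l : ℝ) + 5) - 4 * dmod P) / (((l : ℝ) + 4) * ((l : ℝ) - 3)) * L
        + 6 * l * ((l : ℝ) + 5) / (((l : ℝ) + 4) * ((l : ℝ) - 3)) * Real.log Real.pi) =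
      6 * l * (((l : ℝ) + 5) - 4 * dmod P) * L + 6 * l * ((l : ℝ) + 5) * Real.log Real.pi := by
    have h4 : (l : ℝ) + 4 ≠ 0 := by linarith
    have h3 : (l : ℝ) - 3 ≠ 0 := by linarith
    rw [mul_add]
    congr 1
    · rw [div_mul_eq_mul_div, mul_div_assoc', mul_div_cancel_left₀ _ (mul_ne_zero h4 h3)]
    · rw [div_mul_eq_mul_div, mul_div_assoc', mul_div_cancel_left₀ _ (mul_ne_zero h4 h3)]
  rw [e1] at h'
  nlinarith [h', hL0, hQ0, hpi0, hc0]

/-- **`d_mod = 1` — THE HEADLINE** (every `λ` with `j(λ) ∈ ℚ`, in particular every rational `λ ∈ U_X`; `l ≥ 5`):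
**`log q^{∤2l}(λ) ≤ (6l(l+1)/((l+4)(l−3)))·(log-diff(λ) + (1 − 1/l)·log 𝔣^{∤2l}(λ)) + (6l(l+5)/((l+4)(l−3)))·log π ⟹ Cor22.Cor312PerImageAtDatum P l`**:
a Szpiro inequality for `E_λ` away from `2l` with constant `6l(l+1)/((l+4)(l−3))` (`= 6.6` at `l = 11`, `6.13` at `l = 23`, `↓ 6`)
IMPLIES the registered (P)-line crux of the IUT route at `(P, l)`. Kernel statement about the tree's typed objects; no side taken on
[IUTchIII] Cor. 3.12. [cite: Mochizuki2012, IUTchIII Cor. 3.12 p. 173–174] [cite: Mochizuki2012, IUTchIV Thm. 1.10 p. 22–23; Cor. 2.2 (ii) p. 46]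
[claim: Mochizuki2012, status: disputed] -/
theorem cor312PerImageAtDatum_of_szpiroSix (hU : P.InU) (h5 : 5 ≤ l) (hd : dmod P = 1)
    (h : logQAvoid P {2, l} ≤
      6 * l * ((l : ℝ) + 1) / (((l : ℝ) + 4) * ((l : ℝ) - 3))
          * (P.logDiff + (1 - 1 / (l : ℝ)) * logCondAvoid P {2, l})
        + 6 * l * ((l : ℝ) + 5) / (((l : ℝ) + 4) * ((l : ℝ) - 3)) * Real.log Real.pi) :
    Cor312PerImageAtDatum P l := by
  have hdR : (dmod P : ℝ) = 1 := by exact_mod_cast hd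
  have hl5 : (5 : ℝ) ≤ l := by exact_mod_cast h5
  refine cor312PerImageAtDatum_of_szpiro hU h5 (by rw [hdR]; linarith) ?_
  rw [hdR]
  have e : ((l : ℝ) + 5) - 4 * 1 = (l : ℝ) + 1 := by ring
  rw [e]
  exact h

/-- **THE SANDWICH AT `d_mod = 1` (both halves by this seat, kernel)**: for `λ ∈ U_X` minimally presented (`P ∈ UP`) with `j(λ) ∈ ℚ`
and a prime `l ≥ 7`:
(⇐) `log q^{∤2l} ≤ (6l(l+1)/((l+4)(l−3)))·(log-diff + (1 − 1/l)·log-cond) + (6l(l+5)/((l+4)(l−3)))·log π ⟹ Cor312PerImageAtDatum P l`;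
(⇒) `Cor312PerImageAtDatum P l ⟹` at every TAME genuine datum `T` of `(P, l)`:
`(1/6 − 2/(l(l+1)))·log q^{∤2l} ≤ (1 + 12/l)·(log-diff + log-cond) + 5·log l + 46 + 2·log π` (p437841).
Both Szpiro constants tend to `6`. No side taken on which holds at any given point. [cite: Mochizuki2012, IUTchIII Cor. 3.12 p. 173–174]
[cite: Mochizuki2012, IUTchIV Thm. 1.10 p. 22–23] [claim: Mochizuki2012, status: disputed] -/
theorem cor312PerImageAtDatum_sandwich_dmod_one (hP : P ∈ UP) (h7 : 7 ≤ l) (hd : dmod P = 1) :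
    (logQAvoid P {2, l} ≤
        6 * l * ((l : ℝ) + 1) / (((l : ℝ) + 4) * ((l : ℝ) - 3))
            * (P.logDiff + (1 - 1 / (l : ℝ)) * logCondAvoid P {2, l})
          + 6 * l * ((l : ℝ) + 5) / (((l : ℝ) + 4) * ((l : ℝ) - 3)) * Real.log Real.pi →
      Cor312PerImageAtDatum P l) ∧
    (Cor312PerImageAtDatum P l → ∀ T : ThetaVolumeDatumAt P l,
      (letI := T.instFieldF; letI := T.instNumberFieldF; letI := T.instAlgebraF; letI := T.instFieldK
       letI := T.instNumberFieldK; letI := T.instAlgebraK; letI := T.instIsElliptic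
       ∀ (p : ℕ) [hp : Fact p.Prime], p ∈ T.I.supportPrimes → ∀ v : placesOver (fieldOfModuli T.E) p,
         ¬ p - 2 < absRamificationIdx p ((T.I.σ.localFieldFamily p hp.out).k v)) →
      (1 / 6 - 2 / ((l : ℝ) * ((l : ℝ) + 1))) * logQAvoid P {2, l} ≤
        (1 + 12 / (l : ℝ)) * (P.logDiff + logCondAvoid P {2, l}) + 5 * Real.log l + 46 + 2 * Real.log Real.pi) := by
  refine ⟨fun h => cor312PerImageAtDatum_of_szpiroSix hP.1 (by omega) hd h, fun h T htame => ?_⟩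
  have hmain := PointDict.szpiro_of_cor312PerImageAtDatum_tame_six hP h7 h T htame
  have hdR : (dmod P : ℝ) = 1 := by exact_mod_cast hd
  rw [hdR] at hmain
  have e : (4 + 8 * (1 : ℝ)) = 12 := by norm_num
  rw [e] at hmain
  exact hmain

end Literature.IUT.LogVolume.Cor22

end
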